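import Summits.ValiantsHypothesis.ValiantsHypothesis.Theorems.BarrierLeverPartitionMinorsChowLockedCoreEngine

/-!
# Route BarrierLever — Chow witnesses for partition minors: the conclusion of item 20172 (CPM) for
# EVERY layout of height `h ≤ 2` (first complete finite slice; the locked core is empty there)

Helper file (`--supports stmt-ValiantsHypothesis-20195`; cell valiant-natproofs, rung V4, 𝒟-side of
door (c); seat val-np-p4 gen 10).  Closes NO item.

The locked-core engine for Chow witnesses (`chow_height_le_of_lockedCore`, file
`…PartitionMinorsChowLockedCoreEngine`) reduces «every injective layout of height `≤ H₀` is hit by a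
product of `h + h` affine forms» to the LOCKED injective layouts of height `≤ H₀`.  A seat census
(work/locked_small.py) finds NO locked pair at heights `1` and `2` (and `224` at height `3`, each with
a small-integer Chow witness — not treated here).  This file turns the heights `≤ 2` into a kernel
theorem:

* `chow_hit_height_zero` — height `0` (at most one row: the empty product hits it);
* `unlocked_height_one`, `unlocked_height_two` — two small `decide`s over pairs of families of
  subsets of `Fin 1` / `Fin 2`: some row class and some column class have equal size;
* `card_filter_mem_eq_card_image_filter` — the bridge from an injective layout to its family;
* `chowHits_of_height_le_two` — **for every `h ≤ 2`, every `r` and every injective layout pair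
  `u w : Fin r → Finset (Fin h)`, some product of `h + h` affine forms has nonzero partition minor**
  (item 20172's conclusion verbatim at these heights; the item itself asks for all LARGE `h`).

WHAT THIS IS NOT: a toy-height slice validating the engine end to end; nothing on items 20172 / 20195
/ 19717 themselves, on crux stmt-ValiantsHypothesis-14610, or on `VP` versus `VNP`.
-/

set_option linter.dupNamespace false

namespace Summit.ValiantsHypothesis.ValiantsHypothesis.Theorems.BarrierLever.ChowFactor

open Finset MvPolynomial

noncomputable section

/-! ## 1. Height `0` -/

/-- **Height `0`**: an injective layout has at most one row (the empty face), and the empty product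
`1` hits it. -/
theorem chow_hit_height_zero (r : ℕ) (u w : Fin r → Finset (Fin 0)) (hu : Function.Injective u) :
    ∃ ℓ : Fin (0 + 0) → MvPolynomial (Fin (0 + 0)) ℂ, (∀ q, (ℓ q).totalDegree ≤ 1) ∧
      (Matrix.of fun i j : Fin r => coeff
        (∑ b ∈ u i, Finsupp.single (Fin.castAdd 0 b) 1 + ∑ d ∈ w j, Finsupp.single (Fin.natAdd 0 d) 1)
        (∏ q, ℓ q)).det ≠ 0 := by
  classical
  have hr : r ≤ 1 := by
    have := Fintype.card_le_of_injective u hu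
    simpa using this
  refine ⟨fun _ => 0, fun _ => by rw [totalDegree_zero]; exact Nat.zero_le _, ?_⟩
  have hempty : ∀ S : Finset (Fin 0), S = ∅ := fun S => Finset.eq_empty_of_isEmpty S
  have hM : (Matrix.of fun i j : Fin r => coeff
      (∑ b ∈ u i, Finsupp.single (Fin.castAdd 0 b) 1 + ∑ d ∈ w j, Finsupp.single (Fin.natAdd 0 d) 1)
      (∏ q : Fin (0 + 0), (fun _ => (0 : MvPolynomial (Fin (0 + 0)) ℂ)) q)) =
      Matrix.of fun _ _ : Fin r => (1 : ℂ) := by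
    haveI : IsEmpty (Fin (0 + 0)) := by
      change IsEmpty (Fin 0)
      infer_instance
    ext i j
    rw [Matrix.of_apply, Matrix.of_apply, hempty (u i), hempty (w j), Finset.sum_empty,
      Finset.sum_empty, add_zero (0 : Fin (0 + 0) →₀ ℕ), Finset.univ_eq_empty, Finset.prod_empty,
      coeff_zero_one]
  rw [hM]
  rcases Nat.le_one_iff_eq_zero_or_eq_one.mp hr with rfl | rfl
  · simp [Matrix.det_isEmpty]
  · rw [Matrix.det_unique]
    simp

/-! ## 2. Heights `1` and `2` have no locked pair (decided) -/

/-- No locked pair of families at height `1`. -/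
theorem unlocked_height_one : ∀ U W : Finset (Finset (Fin 1)), U.card = W.card →
    ∃ a c : Fin 1, (U.filter fun S => a ∈ S).card = (W.filter fun S => c ∈ S).card ∨
      (U.filter fun S => a ∈ S).card + (W.filter fun S => c ∈ S).card = U.card := by
  decide

set_option maxRecDepth 20000 in
set_option maxHeartbeats 4000000 in
/-- No locked pair of families at height `2`. -/
theorem unlocked_height_two : ∀ U W : Finset (Finset (Fin 2)), U.card = W.card →
    ∃ a c : Fin 2, (U.filter fun S => a ∈ S).card = (W.filter fun S => c ∈ S).card ∨
      (U.filter fun S => a ∈ S).card + (W.filter fun S => c ∈ S).card = U.card := by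
  decide

/-! ## 3. From a layout to its family -/

/-- The class size of a coordinate is read off the family of faces. -/
theorem card_filter_mem_eq_card_image_filter {n r : ℕ} (v : Fin r → Finset (Fin n))
    (hv : Function.Injective v) (a : Fin n) :
    (Finset.univ.filter fun i => a ∈ v i).card =
      ((Finset.univ.image v).filter fun S => a ∈ S).card := by
  classical
  rw [← Finset.card_image_of_injective (Finset.univ.filter fun i => a ∈ v i) hv]
  congr 1
  ext S
  simp only [Finset.mem_image, Finset.mem_filter, Finset.mem_univ, true_and]
  constructor
  · rintro ⟨i, hi, rfl⟩
    exact ⟨⟨i, rfl⟩, hi⟩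
  · rintro ⟨⟨i, rfl⟩, hS⟩
    exact ⟨i, hS, rfl⟩

/-- An «unlocked» certificate on families contradicts the locked hypothesis of the engine. -/
theorem not_locked_of_families {n r : ℕ} (u w : Fin r → Finset (Fin n))
    (hu : Function.Injective u) (hw : Function.Injective w) (a c : Fin n)
    (hac : ((Finset.univ.image u).filter fun S => a ∈ S).card =
        ((Finset.univ.image w).filter fun S => c ∈ S).card ∨
      ((Finset.univ.image u).filter fun S => a ∈ S).card +
        ((Finset.univ.image w).filter fun S => c ∈ S).card = (Finset.univ.image u).card)
    (hlk : ∀ (a c : Fin n) (β γ : Bool),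
      (Finset.univ.filter fun i => (a ∈ u i ↔ β = true)).card ≠
        (Finset.univ.filter fun j => (c ∈ w j ↔ γ = true)).card) : False := by
  classical
  rw [← card_filter_mem_eq_card_image_filter u hu a, ← card_filter_mem_eq_card_image_filter w hw c,
    Finset.card_image_of_injective _ hu, Finset.card_univ, Fintype.card_fin] at hac
  rcases hac with h1 | h2
  · apply hlk a c true true
    rw [card_filter_iff_eq, card_filter_iff_eq, if_pos rfl, if_pos rfl]
    exact h1
  · apply hlk a c true false
    rw [card_filter_iff_eq, card_filter_iff_eq, if_pos rfl, if_neg Bool.false_ne_true]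
    have hwc := card_filter_mem_add_card_filter_not_mem w c
    omega

/-! ## 4. CPM for every layout of height `≤ 2` -/

/-- **Item 20172's conclusion for every injective layout pair of height `h ≤ 2`, every `r`.** -/
theorem chowHits_of_height_le_two (h r : ℕ) (hh : h ≤ 2) (u w : Fin r → Finset (Fin h))
    (hu : Function.Injective u) (hw : Function.Injective w) :
    ∃ ℓ : Fin (h + h) → MvPolynomial (Fin (h + h)) ℂ, (∀ q, (ℓ q).totalDegree ≤ 1) ∧
      (Matrix.of fun i j : Fin r => coeff
        (∑ b ∈ u i, Finsupp.single (Fin.castAdd h b) 1 + ∑ d ∈ w j, Finsupp.single (Fin.natAdd h d) 1)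
        (∏ q, ℓ q)).det ≠ 0 := by
  classical
  refine chow_height_le_of_lockedCore 2 (fun h r hh2 u w hu hw hlk => ?_) h hh r u w hu hw
  rcases (by omega : h = 0 ∨ h = 1 ∨ h = 2) with rfl | rfl | rfl
  · exact chow_hit_height_zero r u w hu
  · exfalso
    obtain ⟨a, c, hac⟩ := unlocked_height_one (Finset.univ.image u) (Finset.univ.image w)
      (by rw [Finset.card_image_of_injective _ hu, Finset.card_image_of_injective _ hw])
    exact not_locked_of_families u w hu hw a c hac hlk
  · exfalso
    obtain ⟨a, c, hac⟩ := unlocked_height_two (Finset.univ.image u) (Finset.univ.image w)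
      (by rw [Finset.card_image_of_injective _ hu, Finset.card_image_of_injective _ hw])
    exact not_locked_of_families u w hu hw a c hac hlk

end

end Summit.ValiantsHypothesis.ValiantsHypothesis.Theorems.BarrierLever.ChowFactor
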